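import Summits.Ventures.PercRepro.C026HGraph
import Summits.Ventures.PercRepro.C026HubPairBits

/-!
# Hub-pair graphs, II: the finite model of a supported graph and its transfer lemmas (p5, gen 11)

A marked multigraph is **supported** on `ι 0, …, ι (n-1)` (`Supported G ι n`) when every edge has
both endpoints among these vertices; the marks are `a = ι 0`, `b = ι 1`, `c = ι 2`.  For such a graph
and a configuration `ω` the **open rows** `oRows` (bit `j` of row `i`: some open edge joins `ι i` and
`ι j`, `i ≠ j`) and the **closed rows** `cRows` determine every event of mine-3's H-graph:

* `conn_iff_reachB` — `ι i ↔ ι j` in `ω` iff `j ∈ reach n (oRows ω) i`;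
* `hAdj_iff` — an H-step `ι i ~_H ι j` is the bit `hBit` computed from the open rows, the closed
  rows, the open closure and the mask `M` of `c`'s cluster;
* `hConnAvoid_iff` — an H-walk avoiding `X` is reachability in the rows `avoid n (hRows …) X`;
* `isBot_iff_botB`, `hConnAvoid_ca_iff_o1B`, `hConnAvoid_cb_iff_o2B`, `hConn_ab_iff_badB` — `bot`,
  `o1`, `o2`, `BAD` of a supported graph are the bits `botB`, `o1B`, `o2B`, `badB` of its rows.

All the model functions are kernel-computable (`C026HubPairBits.lean`), so that statements about
every configuration of every supported graph reduce to `decide +kernel` over the rows.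
-/

namespace PercRepro

namespace PairModel

/-! ### The model: H-adjacency and the events, on rows -/

/-- The H-adjacency bit of `i, j` from the open rows `O`, the closed rows `C`, the open closure rows
`Ocl` and the mask `M` of `c`'s cluster: a closed edge inside `M`, an edge between `M` and its
complement, or open connectivity outside `M` (`HAdj`). -/
def hBit (O C Ocl : Rows) (M : ℕ) (i j : ℕ) : Bool :=
  (i != j) && ((M.testBit i && M.testBit j && adj C i j) ||
    ((M.testBit i != M.testBit j) && (adj O i j || adj C i j)) ||
    (!M.testBit i && !M.testBit j && adj Ocl i j))

/-- The rows of the H-adjacency. -/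
def hRows (n : ℕ) (O C Ocl : Rows) (M : ℕ) : Rows :=
  (List.range n).map fun i => maskOf n (hBit O C Ocl M i)

/-- The rows with the vertices of the mask `X` deleted. -/
def avoid (n : ℕ) (H : Rows) (X : ℕ) : Rows :=
  (List.range n).map fun i => maskOf n fun j => !X.testBit i && !X.testBit j && adj H i j

/-- The rows of the open closure (reachability in `O`). -/
def closureRows (n : ℕ) (O : Rows) : Rows :=
  (List.range n).map fun i => maskOf n fun j => reachB n O i j

/-- `bot`: the marks `0, 1, 2` pairwise not connected. -/
def botB (n : ℕ) (O : Rows) : Bool :=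
  !reachB n O 0 1 && !reachB n O 0 2 && !reachB n O 1 2

/-- The H-rows of the state `(O, C)`. -/
def hOf (n : ℕ) (O C : Rows) : Rows := hRows n O C (closureRows n O) (reach n O 2)

/-- `o1`: `c ~_H a` avoiding `L`. -/
def o1B (n : ℕ) (O C : Rows) : Bool := reachB n (avoid n (hOf n O C) (reach n O 1)) 2 0

/-- `o2`: `c ~_H b` avoiding `K`. -/
def o2B (n : ℕ) (O C : Rows) : Bool := reachB n (avoid n (hOf n O C) (reach n O 0)) 2 1

/-- `BAD`: `a ~_H b`. -/
def badB (n : ℕ) (O C : Rows) : Bool := reachB n (avoid n (hOf n O C) 0) 0 1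

/-- The rows of `avoid` are bounded. -/
theorem bounded_avoid (n : ℕ) (H : Rows) (X : ℕ) : Bounded n (avoid n H X) :=
  bounded_of_maskOf n _

/-- The rows of `hRows` are bounded. -/
theorem bounded_hRows (n : ℕ) (O C Ocl : Rows) (M : ℕ) : Bounded n (hRows n O C Ocl M) :=
  bounded_of_maskOf n _

/-- The entries of `hRows`. -/
theorem adj_hRows {n : ℕ} (O C Ocl : Rows) (M : ℕ) {i : ℕ} (hi : i < n) (j : ℕ) :
    adj (hRows n O C Ocl M) i j = (decide (j < n) && hBit O C Ocl M i j) := by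
  simp [adj, hRows, row_map_range hi, testBit_maskOf]

/-- The entries of `avoid`. -/
theorem adj_avoid {n : ℕ} (H : Rows) (X : ℕ) {i : ℕ} (hi : i < n) (j : ℕ) :
    adj (avoid n H X) i j = (decide (j < n) && (!X.testBit i && !X.testBit j && adj H i j)) := by
  simp [adj, avoid, row_map_range hi, testBit_maskOf]

/-- The entries of the H-rows of a state. -/
theorem adj_hOf {n : ℕ} (O C : Rows) {i : ℕ} (hi : i < n) (j : ℕ) :
    adj (hOf n O C) i j = (decide (j < n) && hBit O C (closureRows n O) (reach n O 2) i j) :=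
  adj_hRows _ _ _ _ hi j

/-- The entries of the closure rows. -/
theorem adj_closureRows {n : ℕ} (O : Rows) {i : ℕ} (hi : i < n) (j : ℕ) :
    adj (closureRows n O) i j = (decide (j < n) && reachB n O i j) := by
  simp [adj, closureRows, row_map_range hi, testBit_maskOf]

end PairModel

namespace MultiGraph

open PairModel

variable {V E : Type*} (G : MultiGraph V E) (ι : ℕ → V) (n : ℕ)

/-- **Supported**: every edge has both endpoints among `ι 0, …, ι (n-1)`. -/
def Supported : Prop := ∀ e, (∃ i < n, G.fst e = ι i) ∧ (∃ j < n, G.snd e = ι j)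

/-- `ι` is injective on `{0, …, n-1}`. -/
def InjBelow (ι : ℕ → V) (n : ℕ) : Prop := ∀ i < n, ∀ j < n, ι i = ι j → i = j

open Classical in
/-- The open rows of `ω`: bit `j` of row `i` iff `i ≠ j` and some open edge joins `ι i`, `ι j`. -/
noncomputable def oRows (ω : Config E) : Rows :=
  (List.range n).map fun i => maskOf n fun j =>
    decide (i ≠ j ∧ ∃ e, ω e = true ∧ G.Joins e (ι i) (ι j))

open Classical in
/-- The closed rows of `ω`: bit `j` of row `i` iff `i ≠ j` and some closed edge joins `ι i`, `ι j`. -/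
noncomputable def cRows (ω : Config E) : Rows :=
  (List.range n).map fun i => maskOf n fun j =>
    decide (i ≠ j ∧ ∃ e, ω e = false ∧ G.Joins e (ι i) (ι j))

variable {G ι n}

/-- The open rows are bounded. -/
theorem bounded_oRows (ω : Config E) : Bounded n (G.oRows ι n ω) := bounded_of_maskOf n _

/-- The closed rows are bounded. -/
theorem bounded_cRows (ω : Config E) : Bounded n (G.cRows ι n ω) := bounded_of_maskOf n _

/-- An entry of the open rows. -/
theorem adj_oRows (ω : Config E) {i : ℕ} (hi : i < n) (j : ℕ) :
    adj (G.oRows ι n ω) i j = true ↔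
      j < n ∧ i ≠ j ∧ ∃ e, ω e = true ∧ G.Joins e (ι i) (ι j) := by
  classical
  simp [adj, oRows, row_map_range hi, testBit_maskOf]

/-- An entry of the closed rows. -/
theorem adj_cRows (ω : Config E) {i : ℕ} (hi : i < n) (j : ℕ) :
    adj (G.cRows ι n ω) i j = true ↔
      j < n ∧ i ≠ j ∧ ∃ e, ω e = false ∧ G.Joins e (ι i) (ι j) := by
  classical
  simp [adj, cRows, row_map_range hi, testBit_maskOf]

/-- A chain of the open rows gives open connectivity. -/
theorem conn_of_rtg {ω : Config E} {i j : ℕ}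
    (h : Relation.ReflTransGen (Rel n (G.oRows ι n ω)) i j) : G.Conn ω (ι i) (ι j) := by
  induction h with
  | refl => exact Conn.refl G ω _
  | tail _ hjk ih =>
    obtain ⟨_, _, e, he, hj⟩ := (adj_oRows ω hjk.1 _).1 hjk.2.2
    exact ih.trans (Conn.of_openAdj ⟨e, he, hj⟩)

/-- Reachability in the open rows gives open connectivity. -/
theorem conn_of_reachB_oRows {ω : Config E} {i j : ℕ}
    (h : reachB n (G.oRows ι n ω) i j = true) : G.Conn ω (ι i) (ι j) := by
  rcases reachB_imp_rtg (bounded_oRows ω) h with rfl | hchain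
  · exact Conn.refl G ω _
  · exact conn_of_rtg hchain

variable (hsup : G.Supported ι n)
include hsup

/-- The other endpoint of an edge at a supported vertex is supported. -/
theorem exists_of_joins {e : E} {u v : V} (h : G.Joins e u v) : ∃ k < n, v = ι k := by
  obtain ⟨⟨i, hi, hfst⟩, ⟨j, hj, hsnd⟩⟩ := hsup e
  rcases h with ⟨_, rfl⟩ | ⟨rfl, _⟩
  · exact ⟨j, hj, hsnd⟩
  · exact ⟨i, hi, hfst⟩

/-- An open step from `ι i` lands on a supported vertex and is an entry of the open rows. -/
theorem exists_adj_of_openAdj {ω : Config E} {i : ℕ} (hi : i < n) {v : V}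
    (h : G.OpenAdj ω (ι i) v) : ∃ k < n, v = ι k ∧ (k = i ∨ adj (G.oRows ι n ω) i k = true) := by
  obtain ⟨e, he, hend⟩ := h
  have hj : G.Joins e (ι i) v := hend
  obtain ⟨k, hk, rfl⟩ := exists_of_joins hsup hj
  refine ⟨k, hk, rfl, ?_⟩
  by_cases hki : k = i
  · exact Or.inl hki
  · right
    exact (adj_oRows (G := G) (ι := ι) (n := n) ω hi k).2 ⟨hk, Ne.symm hki, e, he, hj⟩

/-- **Open connectivity is reachability in the open rows** (and lands on supported vertices). -/
theorem exists_reachB_of_conn {ω : Config E} {i : ℕ} (hi : i < n) {v : V}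
    (h : G.Conn ω (ι i) v) : ∃ k < n, v = ι k ∧ reachB n (G.oRows ι n ω) i k = true := by
  refine Conn.induction (motive := fun v => ∃ k < n, v = ι k ∧ reachB n (G.oRows ι n ω) i k = true)
    ⟨i, hi, rfl, reachB_self n _ i⟩ (fun {u v} _ huv ih => ?_) h
  obtain ⟨k, hk, rfl, hr⟩ := ih
  obtain ⟨k', hk', rfl, hkk⟩ := exists_adj_of_openAdj hsup hk huv
  refine ⟨k', hk', rfl, ?_⟩
  rcases hkk with rfl | hadj
  · exact hr
  · exact reachB_of_reachB_adj hk hk' hr hadj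

/-- **Open connectivity of two supported vertices is reachability in the open rows.** -/
theorem conn_iff_reachB (hinj : InjBelow ι n) {ω : Config E} {i j : ℕ} (hi : i < n)
    (hj : j < n) : G.Conn ω (ι i) (ι j) ↔ reachB n (G.oRows ι n ω) i j = true := by
  constructor
  · intro h
    obtain ⟨k, hk, hjk, hr⟩ := exists_reachB_of_conn hsup hi h
    rw [hinj j hj k hk hjk]
    exact hr
  · exact conn_of_reachB_oRows

/-! ### Clusters, H-steps and H-walks -/

/-- Membership of `ι j` in the cluster of `ι i`. -/
theorem mem_cluster_iff (hinj : InjBelow ι n) {ω : Config E} {i j : ℕ} (hi : i < n)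
    (hj : j < n) : ι j ∈ G.cluster ω (ι i) ↔ reachB n (G.oRows ι n ω) i j = true :=
  conn_iff_reachB hsup hinj hi hj

/-- A vertex of the cluster of a supported vertex is supported. -/
theorem exists_of_mem_cluster {ω : Config E} {i : ℕ} (hi : i < n) {v : V}
    (h : v ∈ G.cluster ω (ι i)) : ∃ k < n, v = ι k := by
  obtain ⟨k, hk, hv, _⟩ := exists_reachB_of_conn hsup hi h
  exact ⟨k, hk, hv⟩

omit hsup in
/-- The Boolean shape of `hBit`, as a proposition. -/
theorem hBit_eq_true_iff_aux {i j : ℕ} (hij : i ≠ j) (mi mj oij cij rij : Bool) :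
    ((i != j) && ((mi && mj && cij) || ((mi != mj) && (oij || cij)) ||
      (!mi && !mj && rij))) = true ↔
      ((mi = true ∧ mj = true ∧ cij = true) ∨
        ((mi = true ↔ ¬ mj = true) ∧ (oij = true ∨ cij = true)) ∨
          (¬ mi = true ∧ ¬ mj = true ∧ rij = true)) := by
  have hne : (i != j) = true := bne_iff_ne.mpr hij
  cases mi <;> cases mj <;> cases oij <;> cases cij <;> cases rij <;> simp [hne]

/-- **An H-step between supported vertices is the bit `hBit`** (marks `ι 0, ι 1, ι 2`). -/
theorem hAdj_iff (hinj : InjBelow ι n) (hn : 2 < n) {ω : Config E} {i j : ℕ} (hi : i < n)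
    (hj : j < n) (hij : i ≠ j) :
    G.HAdj ω (ι 2) (ι i) (ι j) ↔
      hBit (G.oRows ι n ω) (G.cRows ι n ω) (closureRows n (G.oRows ι n ω))
        (reach n (G.oRows ι n ω) 2) i j = true := by
  have hMi : ι i ∈ G.cluster ω (ι 2) ↔ (reach n (G.oRows ι n ω) 2).testBit i = true :=
    mem_cluster_iff hsup hinj hn hi
  have hMj : ι j ∈ G.cluster ω (ι 2) ↔ (reach n (G.oRows ι n ω) 2).testBit j = true :=
    mem_cluster_iff hsup hinj hn hj
  have hC : (∃ e, ω e = false ∧ G.Joins e (ι i) (ι j)) ↔ adj (G.cRows ι n ω) i j = true := by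
    rw [adj_cRows ω hi j]
    exact ⟨fun h => ⟨hj, hij, h⟩, fun h => h.2.2⟩
  have hO : (∃ e, ω e = true ∧ G.Joins e (ι i) (ι j)) ↔ adj (G.oRows ι n ω) i j = true := by
    rw [adj_oRows ω hi j]
    exact ⟨fun h => ⟨hj, hij, h⟩, fun h => h.2.2⟩
  have hE : (∃ e, G.Joins e (ι i) (ι j)) ↔
      (adj (G.oRows ι n ω) i j = true ∨ adj (G.cRows ι n ω) i j = true) := by
    rw [← hO, ← hC]
    constructor
    · rintro ⟨e, he⟩
      cases h : ω e
      · exact Or.inr ⟨e, h, he⟩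
      · exact Or.inl ⟨e, h, he⟩
    · rintro (⟨e, _, he⟩ | ⟨e, _, he⟩) <;> exact ⟨e, he⟩
  have hR : G.Conn ω (ι i) (ι j) ↔ adj (closureRows n (G.oRows ι n ω)) i j = true := by
    rw [adj_closureRows _ hi j, conn_iff_reachB hsup hinj hi hj]
    simp [hj]
  unfold HAdj hBit
  rw [hBit_eq_true_iff_aux hij]
  simp only [hMi, hMj, hC, hE, hR]

/-- An H-step from a supported vertex lands on a supported vertex. -/
theorem exists_of_hAdj {ω : Config E} {i : ℕ} (hi : i < n) {v : V}
    (h : G.HAdj ω (ι 2) (ι i) v) : ∃ k < n, v = ι k := by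
  rcases h with ⟨_, _, e, _, hj⟩ | ⟨_, e, hj⟩ | ⟨_, _, hconn⟩
  · exact exists_of_joins hsup hj
  · exact exists_of_joins hsup hj
  · exact exists_of_mem_cluster hsup hi hconn

omit hsup in
/-- `hBit` forces distinct endpoints. -/
theorem ne_of_hBit {O C Ocl : Rows} {M i j : ℕ} (h : hBit O C Ocl M i j = true) : i ≠ j := by
  unfold hBit at h
  exact bne_iff_ne.mp (Bool.and_eq_true _ _ |>.mp h).1

/-- **An H-walk avoiding `X` between supported vertices is reachability in the rows
`avoid n (hOf …) Xm`**, for any mask `Xm` agreeing with `X` on the supported vertices. -/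
theorem hConnAvoid_iff (hinj : InjBelow ι n) (hn : 2 < n) {ω : Config E} {X : Set V} {Xm : ℕ}
    (hX : ∀ k < n, Xm.testBit k = true ↔ ι k ∈ X) {i j : ℕ} (hi : i < n) (hj : j < n) :
    G.HConnAvoid ω (ι 2) X (ι i) (ι j) ↔
      reachB n (avoid n (hOf n (G.oRows ι n ω) (G.cRows ι n ω)) Xm) i j = true := by
  have hXk : ∀ k < n, Xm.testBit k = false ↔ ι k ∉ X := by
    intro k hk
    rw [← hX k hk]
    cases Xm.testBit k <;> simp
  constructor
  · intro h
    have key : ∀ v, Relation.ReflTransGen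
        (fun x y => G.HAdj ω (ι 2) x y ∧ x ∉ X ∧ y ∉ X) (ι i) v →
        ∃ k < n, v = ι k ∧
          reachB n (avoid n (hOf n (G.oRows ι n ω) (G.cRows ι n ω)) Xm) i k = true := by
      intro v hv
      induction hv with
      | refl => exact ⟨i, hi, rfl, reachB_self n _ i⟩
      | tail _ hstep ih =>
        obtain ⟨k, hk, rfl, hr⟩ := ih
        obtain ⟨hadj, hkX, hvX⟩ := hstep
        obtain ⟨k', hk', rfl⟩ := exists_of_hAdj hsup hk hadj
        refine ⟨k', hk', rfl, ?_⟩
        by_cases hkk : k' = k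
        · subst hkk; exact hr
        · have hb : hBit (G.oRows ι n ω) (G.cRows ι n ω) (closureRows n (G.oRows ι n ω))
              (reach n (G.oRows ι n ω) 2) k k' = true :=
            (hAdj_iff hsup hinj hn hk hk' (Ne.symm hkk)).1 hadj
          have hadj' : adj (avoid n (hOf n (G.oRows ι n ω) (G.cRows ι n ω)) Xm) k k' = true := by
            rw [adj_avoid _ _ hk k', adj_hOf _ _ hk k']
            simp only [hk', decide_true, Bool.true_and, Bool.and_eq_true, Bool.not_eq_true']
            exact ⟨⟨(hXk k hk).2 hkX, (hXk k' hk').2 hvX⟩, hb⟩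
          exact reachB_of_reachB_adj hk hk' hr hadj'
    obtain ⟨k, hk, hjk, hr⟩ := key _ h
    rw [hinj j hj k hk hjk]
    exact hr
  · intro h
    have key : ∀ j', Relation.ReflTransGen
        (Rel n (avoid n (hOf n (G.oRows ι n ω) (G.cRows ι n ω)) Xm)) i j' →
        G.HConnAvoid ω (ι 2) X (ι i) (ι j') := by
      intro j' hchain
      induction hchain with
      | refl => exact Relation.ReflTransGen.refl
      | tail _ hab ih =>
        obtain ⟨ha, hb, hadj⟩ := hab
        rw [adj_avoid _ _ ha _, adj_hOf _ _ ha _] at hadj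
        simp only [hb, decide_true, Bool.true_and, Bool.and_eq_true, Bool.not_eq_true'] at hadj
        obtain ⟨⟨hXa, hXb⟩, hbit⟩ := hadj
        exact ih.tail ⟨(hAdj_iff hsup hinj hn ha hb (ne_of_hBit hbit)).2 hbit,
          (hXk _ ha).1 hXa, (hXk _ hb).1 hXb⟩
    rcases reachB_imp_rtg (bounded_avoid n _ Xm) h with rfl | hchain
    · exact Relation.ReflTransGen.refl
    · exact key j hchain

/-! ### The events -/

omit hsup in
/-- `HConn` is `HConnAvoid ∅`. -/
theorem hConn_iff_hConnAvoid_empty {ω : Config E} {c u v : V} :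
    G.HConn ω c u v ↔ G.HConnAvoid ω c ∅ u v := by
  constructor
  · intro h
    induction h with
    | refl => exact Relation.ReflTransGen.refl
    | tail _ hs ih => exact ih.tail ⟨hs, Set.notMem_empty _, Set.notMem_empty _⟩
  · intro h
    induction h with
    | refl => exact Relation.ReflTransGen.refl
    | tail _ hs ih => exact ih.tail hs.1

/-- **`bot` is `botB`.** -/
theorem isBot_iff_botB (hinj : InjBelow ι n) (hn : 2 < n) {ω : Config E} :
    G.IsBot ω (ι 0) (ι 1) (ι 2) ↔ botB n (G.oRows ι n ω) = true := by
  have h0 : 0 < n := by omega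
  have h1 : 1 < n := by omega
  unfold IsBot botB
  rw [conn_iff_reachB hsup hinj h0 h1, conn_iff_reachB hsup hinj h0 hn,
    conn_iff_reachB hsup hinj h1 hn]
  simp [and_assoc]

/-- The mask of the cluster of `ι m` agrees with the cluster. -/
theorem testBit_reach_iff_mem (hinj : InjBelow ι n) {ω : Config E} {m : ℕ} (hm : m < n) :
    ∀ k < n, (reach n (G.oRows ι n ω) m).testBit k = true ↔ ι k ∈ G.cluster ω (ι m) :=
  fun _ hk => (mem_cluster_iff hsup hinj hm hk).symm

/-- **`o1` is `o1B`**: `c ~_H a` avoiding `L`. -/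
theorem hConnAvoid_ca_iff_o1B (hinj : InjBelow ι n) (hn : 2 < n) {ω : Config E} :
    G.HConnAvoid ω (ι 2) (G.cluster ω (ι 1)) (ι 2) (ι 0) ↔
      o1B n (G.oRows ι n ω) (G.cRows ι n ω) = true :=
  hConnAvoid_iff hsup hinj hn (testBit_reach_iff_mem hsup hinj (by omega)) hn (by omega)

/-- **`o2` is `o2B`**: `c ~_H b` avoiding `K`. -/
theorem hConnAvoid_cb_iff_o2B (hinj : InjBelow ι n) (hn : 2 < n) {ω : Config E} :
    G.HConnAvoid ω (ι 2) (G.cluster ω (ι 0)) (ι 2) (ι 1) ↔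
      o2B n (G.oRows ι n ω) (G.cRows ι n ω) = true :=
  hConnAvoid_iff hsup hinj hn (testBit_reach_iff_mem hsup hinj (by omega)) hn (by omega)

/-- **`BAD` is `badB`**: `a ~_H b`. -/
theorem hConn_ab_iff_badB (hinj : InjBelow ι n) (hn : 2 < n) {ω : Config E} :
    G.HConn ω (ι 2) (ι 0) (ι 1) ↔ badB n (G.oRows ι n ω) (G.cRows ι n ω) = true := by
  rw [hConn_iff_hConnAvoid_empty]
  exact hConnAvoid_iff hsup hinj hn (Xm := 0) (fun _ _ => by simp) (by omega) (by omega)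

end MultiGraph

end PercRepro
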